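import Summits.CriticalPhenomena.SAWScalingLimit.Theses.SAWSpinMonotone
import Literature.Probability.Percolation.TriApproxDomain

/-!
# Line `farnear` for the crux `SAWSpinMonotone.DressingTransfer` — concentration dichotomy with an
in-phase dressing budget (far–near factorisation of the first-arrival law)

(crux item stmt-CriticalPhenomena-16771, rank 4 of `route-CriticalPhenomena-SAWSpinMonotone`; sub-problem
`SAWScalingLimit`; strategist planner-cstrat-stmt-CriticalPhenomena-16771-b1-0, 2026-08-17; tree path
`Summits/CriticalPhenomena/SAWScalingLimit/Cruxes/DressingTransfer/Lines/farnear.lean`; ALTERNATIVE to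
`Lines/birth.lean`, sharing its local vocabulary and its stubs A, S, F.)

Crux (FIXED, by name): `DressingTransfer := SpinMonotone → ArrivalFlattening → (K) ∧ (M)`.

## The line in one paragraph

By the mode identities (stub A, validated numerically to `1e-16` on 1 548 exact cases this session)
`ΣF = α_T G₅ − √3 D₅` and `‖B‖ = ‖β_T G₁₁ + √3 D₁₁‖`, where `G_s` is the first-arrival spin transform at `v` and
`D_s = Σ_γ e^{-isW(γ)} x_c^{ℓ(γ)} L_γ` its loop dressing.  ONLY TWO functionals of the dressing enter (K):
the IN-PHASE part `Re(D₅·conj G₅)` (it lowers `‖ΣF‖`) and `‖D₁₁‖` (it raises `‖B‖`), and they share ONE budget: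
(K) at `v ∉ a` follows from (FM) as soon as `Re(D₅ conj G₅) ≤ ρ‖G₅‖²`, `‖D₁₁‖ ≤ λ'‖G₅‖` with
`ρ + λ' < 2 x_c sin(π/8) = (α_T − β_T)/√3 = 0.414` (`beltrami_upper`, `trivial_lower`, `budget_consts`; birth needs the two-sided
`‖D₅‖, ‖D₁₁‖ ≤ λ‖G₅‖` with `λ < 0.207`).  The dressing is then split by the CONCENTRATION
`c(v) = ‖G₅‖/G₀` (`G₀ = arrivalMass`, the `s = 0` transform), not by depth:
* CONCENTRATED vertices (`‖G₅‖ > G₀/2`): the budget is met TRIVIALLY from a loop bound — `‖D_s‖ ≤ L★·G₀ <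
  (L★/θ)‖G₅‖` (`norm_dressedTransform_le`, `θ = spreadCut = 1/2`), so `ρ = λ' = L★/θ` and `2L★/θ < 0.414` iff
  the returning-loop generating function is `< θ sin(π/8) = 0.191` (stub L, `LoopHalfBound`; whole-plane sup
  `≈ 0.12–0.13` by exact series to length 34 + tail, this session — NOT the `0.081` of small domains);
* SPREAD vertices (`‖G₅‖ ≤ G₀/2`): the budget is the genuine content (stub SB, `SpreadBudget`) — by the
  far–near factorisation of the first-arrival law (last entrance into a ball around `v`: an exact mixture of
  convolutions, the dressing riding on the near factor) the ratios `D_s/G₅` are LOCAL quantities; the spread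
  regime begins at depth ≈ 8 (c = 0.47 / 0.40 / 0.36 / 0.30 at depth 9 / 13 / 17 / 25 by validated Monte Carlo, this
  seat; `c ∼ R^{-0.42}`) and THERE cone = dom5 = 0.053 / 0.059 / 0.062 / 0.067 (creeping up ≈ +0.012 per e-fold of
  depth), dom11 = 0.013 / 0.012 / 0.010 / 0.009 (falling), K = 0.14 / 0.11 / 0.10 / 0.077 (`K ∼ R^{-0.6}`): `ρ + λ' ≈
  0.08` against the budget `0.414`; the engine is the single-scale local/far mixing that drives `ArrivalFlattening`,
  and the precise content is a RACE: phase cancellation shrinks `‖G₅‖/G₀ ∼ R^{-0.42}` while the near entrance type must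
  decorrelate from the far sheet at least as fast (far–near predicts the in-phase ratio turns over once the far
  winding spread exceeds one phase period `2π/σ`, depth ∼ 10³–10⁴, peak ≲ 0.13 by log-extrapolation, then decays to ≈ m̄).
(M) follows from (WCLT) + dressed flattening (stub F, shared with birth) + the lower bound
`‖ΣF‖ ≥ (α_T − √3·max(L★/θ, ρ))‖G₅‖` valid in both regimes.  The source vertex `v ∈ a` is stub S (shared).

Composition `DressingTransfer_of : A → S → L → SB → F → DressingTransfer` is kernel-checked and sorry-free and
consumes both antecedents (FM) and (WCLT) of the crux.
-/

noncomputable section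

open Literature.Probability.LatticeModels
open Literature.Probability.RandomPlanarGeometry

namespace Summit.CriticalPhenomena.SAWScalingLimit.Cruxes.DressingTransfer.Farnear

/-! ## 1. Local vocabulary (verbatim the objects of `Lines/birth.lean`, plus the arrival mass `G₀`) -/

/-- First-arrival spin transform `G_s(v) = Σ_i F_{Λ∖v}(a, {v,wᵢ}; x_c, s)` (the quantity of `SpinMonotone` /
`ArrivalFlattening`). -/
def arrivalTransform (Λ : Finset HexVertex) (a : Sym2 HexVertex) (v w₀ w₁ w₂ : HexVertex) (s : ℝ) : ℂ :=
  SAW.hexParafermionicObservable (Λ.erase v) a SAW.hexCriticalFugacity s s(v, w₀) +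
    SAW.hexParafermionicObservable (Λ.erase v) a SAW.hexCriticalFugacity s s(v, w₁) +
    SAW.hexParafermionicObservable (Λ.erase v) a SAW.hexCriticalFugacity s s(v, w₂)

/-- Arrival mass `G₀(v) = Σ_i Σ_{γ : a → {v,wᵢ} in Λ∖v} x_c^{ℓ(γ)}` — the spin-`0` transform, a non-negative real
(the total weight of the first-arrival winding law). -/
def arrivalMass (Λ : Finset HexVertex) (a : Sym2 HexVertex) (v w₀ w₁ w₂ : HexVertex) : ℝ :=
  (∑ γ : SAW.HexMidEdgeSAW (Λ.erase v) a s(v, w₀), SAW.hexCriticalFugacity ^ γ.length) +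
    (∑ γ : SAW.HexMidEdgeSAW (Λ.erase v) a s(v, w₁), SAW.hexCriticalFugacity ^ γ.length) +
    (∑ γ : SAW.HexMidEdgeSAW (Λ.erase v) a s(v, w₂), SAW.hexCriticalFugacity ^ γ.length)

/-- Returning-loop dressing `L_γ(w → w') = x_c · Σ_η x_c^{ℓ(η)}`, `η` over the SAWs of `(Λ.erase v) ∖ γ` from the
mid-edge `{v,w}` to the mid-edge `{v,w'}` (verbatim `birth.loopDressing`; the inner sum is the one bounded by
the route's support item `LoopDressingBound`). -/
def loopDressing (Λ : Finset HexVertex) (v : HexVertex) {a z : Sym2 HexVertex}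
    (γ : SAW.HexMidEdgeSAW (Λ.erase v) a z) (w w' : HexVertex) : ℝ :=
  SAW.hexCriticalFugacity *
    ∑ η : SAW.HexMidEdgeSAW ((Λ.erase v) \ γ.verts.toFinset) s(v, w) s(v, w'),
      SAW.hexCriticalFugacity ^ η.length

/-- Loop-dressed first-arrival transform `D_s(v)` (verbatim `birth.dressedTransform`). -/
def dressedTransform (Λ : Finset HexVertex) (a : Sym2 HexVertex) (v w₀ w₁ w₂ : HexVertex) (s : ℝ) : ℂ :=
  (∑ γ : SAW.HexMidEdgeSAW (Λ.erase v) a s(v, w₀),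
      γ.weight SAW.hexCriticalFugacity s * (loopDressing Λ v γ w₁ w₂ : ℂ)) +
    (∑ γ : SAW.HexMidEdgeSAW (Λ.erase v) a s(v, w₁),
      γ.weight SAW.hexCriticalFugacity s * (loopDressing Λ v γ w₂ w₀ : ℂ)) +
    (∑ γ : SAW.HexMidEdgeSAW (Λ.erase v) a s(v, w₂),
      γ.weight SAW.hexCriticalFugacity s * (loopDressing Λ v γ w₀ w₁ : ℂ))

/-- Trivial mode `ΣF` of the full observable at `v` (the right-hand side of (K)/(M)). -/
def trivialMode (Λ : Finset HexVertex) (a : Sym2 HexVertex) (v w₀ w₁ w₂ : HexVertex) : ℂ :=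
  SAW.hexParafermionicObservable Λ a SAW.hexCriticalFugacity (5 / 8) s(v, w₀) +
    SAW.hexParafermionicObservable Λ a SAW.hexCriticalFugacity (5 / 8) s(v, w₁) +
    SAW.hexParafermionicObservable Λ a SAW.hexCriticalFugacity (5 / 8) s(v, w₂)

/-- Beltrami mode `B = F₀ + ωF₁ + ω²F₂` of the full observable at `v` (the left-hand side of (K)/(M)). -/
def beltramiMode (Λ : Finset HexVertex) (a : Sym2 HexVertex) (v w₀ w₁ w₂ : HexVertex) : ℂ :=
  SAW.hexParafermionicObservable Λ a SAW.hexCriticalFugacity (5 / 8) s(v, w₀) +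
    Complex.exp (2 * Real.pi * Complex.I / 3) *
      SAW.hexParafermionicObservable Λ a SAW.hexCriticalFugacity (5 / 8) s(v, w₁) +
    Complex.exp (2 * Real.pi * Complex.I / 3) ^ 2 *
      SAW.hexParafermionicObservable Λ a SAW.hexCriticalFugacity (5 / 8) s(v, w₂)

/-- `α_T = 1 + 2x_c cos(5π/24)`. -/
def alphaT : ℝ := 1 + 2 * SAW.hexCriticalFugacity * Real.cos (5 * Real.pi / 24)

/-- `β_T = 1 + 2x_c cos(11π/24)`. -/
def betaT : ℝ := 1 + 2 * SAW.hexCriticalFugacity * Real.cos (11 * Real.pi / 24)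

/-- The CONCENTRATION CUT `θ = 1/2` shared by stubs L and SB: a vertex is *spread* when `‖G₅‖ ≤ θ·G₀`; the
concentrated regime is discharged by the loop bound `Z < θ·sin(π/8)`.  Any common `θ ∈ (0,1]` gives the same glue
(L(θ) needs `Z_sup < θ sin(π/8)`, observed `Z_sup ≈ 0.12–0.13 = 0.33·sin(π/8)`; SB(θ) covers `c(v) ≤ θ`). -/
def spreadCut : ℝ := 1 / 2

/-- `0 < θ`. -/
theorem spreadCut_pos : 0 < spreadCut := by unfold spreadCut; norm_num

/-! ## 2. The five statements of the line -/

/-- **(A) Mode identities** — as in `birth` (I1) `ΣF = α_T G₅ − √3 D₅`, (I2) `‖B‖ ≤ ‖β_T G₁₁ + √3 D₁₁‖`,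
for `v ∉ a`. -/
def ModeIdentities : Prop :=
  ∀ (Λ : Finset HexVertex), SAW.hexDomainSimplyConnected Λ → ∀ a ∈ SAW.hexDomainBoundary Λ, ∀ v ∈ Λ, v ∉ a →
    ∀ w₀ w₁ w₂ : HexVertex, hexGraph.Adj v w₀ → hexGraph.Adj v w₁ → hexGraph.Adj v w₂ →
      w₀ ≠ w₁ → w₁ ≠ w₂ → w₀ ≠ w₂ →
        trivialMode Λ a v w₀ w₁ w₂ =
            (alphaT : ℂ) * arrivalTransform Λ a v w₀ w₁ w₂ (5 / 8) -
              (Real.sqrt 3 : ℂ) * dressedTransform Λ a v w₀ w₁ w₂ (5 / 8) ∧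
          ‖beltramiMode Λ a v w₀ w₁ w₂‖ ≤
            ‖(betaT : ℂ) * arrivalTransform Λ a v w₀ w₁ w₂ (11 / 8) +
              (Real.sqrt 3 : ℂ) * dressedTransform Λ a v w₀ w₁ w₂ (11 / 8)‖

/-- **(S) No fold at the source vertex** — as in `birth`. -/
def SourceNoFold : Prop :=
  ∃ k : ℝ, k < 1 ∧ ∀ (Λ : Finset HexVertex), SAW.hexDomainSimplyConnected Λ → ∀ a ∈ SAW.hexDomainBoundary Λ,
    ∀ v ∈ Λ, v ∈ a → ∀ w₀ w₁ w₂ : HexVertex, hexGraph.Adj v w₀ → hexGraph.Adj v w₁ → hexGraph.Adj v w₂ →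
      w₀ ≠ w₁ → w₁ ≠ w₂ → w₀ ≠ w₂ →
        ‖beltramiMode Λ a v w₀ w₁ w₂‖ ≤ k * ‖trivialMode Λ a v w₀ w₁ w₂‖

/-- **(L) Half loop bound** (`LoopHalfBound`): the returning-loop generating function is uniformly below `θ`
times the single-class fold threshold: `∃ c < θ·sin(π/8) = 0.1913…` (`θ = spreadCut = 1/2`), for all simply
connected `Λ`, boundary `a`, `v`, ports and every first-arrival prefix `γ`, `Σ_η x_c^{ℓ(η)} ≤ c` (verbatim the
route's support item `LoopDressingBound` with its constant halved).  The sup is the WHOLE-PLANE generating function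
of returns from port `k` to port `i` avoiding `v` and a ray from `w_j` (only the non-separating winding type
survives `γ`): `0.0937` to length 34 exactly, `≈ 0.12–0.13` with the `n^{-3/2}` tail (this session) — not the
`0.081` seen inside domains of ≤ 97 vertices.  It makes the dressing budget automatic at every CONCENTRATED vertex
(`‖G₅‖ > θ·G₀`). -/
def LoopHalfBound : Prop :=
  ∃ c : ℝ, c < Real.sin (Real.pi / 8) * spreadCut ∧ ∀ (Λ : Finset HexVertex), SAW.hexDomainSimplyConnected Λ →
    ∀ a ∈ SAW.hexDomainBoundary Λ, ∀ v ∈ Λ, ∀ w₀ w₁ w₂ : HexVertex,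
      hexGraph.Adj v w₀ → hexGraph.Adj v w₁ → hexGraph.Adj v w₂ → w₀ ≠ w₁ → w₁ ≠ w₂ → w₀ ≠ w₂ →
        ∀ γ : SAW.HexMidEdgeSAW (Λ.erase v) a s(v, w₀),
          (∑ η : SAW.HexMidEdgeSAW ((Λ.erase v) \ γ.verts.toFinset) s(v, w₁) s(v, w₂),
            SAW.hexCriticalFugacity ^ η.length) ≤ c

/-- **(SB) Spread budget** (`SpreadBudget`): there are `ρ`, `λ' ≥ 0` with `ρ + λ' < 2 x_c sin(π/8)` (the shared
fold budget `(α_T − β_T)/√3`) such that at every SPREAD vertex `v ∉ a` — one whose first-arrival law has lost at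
least half of its spin-`5/8` mode, `‖G₅‖ ≤ G₀/2` — the IN-PHASE spin-`5/8` dressing and the spin-`11/8` dressing
obey `Re(D₅ · conj G₅) ≤ ρ‖G₅‖²` and `‖D₁₁‖ ≤ λ'‖G₅‖`.  (One-sided at `5/8`, budget shared with `11/8`; by the
far–near factorisation both ratios are local quantities; measured in the spread regime itself (depth 9–25, c = 0.47–0.30):
`Re(D₅ conj G₅)/‖G₅‖² = 0.053 → 0.067` creeping up ≈ 0.012 per e-fold of depth, `‖D₁₁‖/‖G₅‖ = 0.013 → 0.009` falling.) -/
def SpreadBudget : Prop :=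
  ∃ ρ lam : ℝ, 0 ≤ lam ∧ ρ + lam < 2 * SAW.hexCriticalFugacity * Real.sin (Real.pi / 8) ∧
    ∀ (Λ : Finset HexVertex), SAW.hexDomainSimplyConnected Λ → ∀ a ∈ SAW.hexDomainBoundary Λ, ∀ v ∈ Λ, v ∉ a →
      ∀ w₀ w₁ w₂ : HexVertex, hexGraph.Adj v w₀ → hexGraph.Adj v w₁ → hexGraph.Adj v w₂ →
        w₀ ≠ w₁ → w₁ ≠ w₂ → w₀ ≠ w₂ →
          ‖arrivalTransform Λ a v w₀ w₁ w₂ (5 / 8)‖ ≤ spreadCut * arrivalMass Λ a v w₀ w₁ w₂ →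
            (dressedTransform Λ a v w₀ w₁ w₂ (5 / 8) *
                (starRingEnd ℂ) (arrivalTransform Λ a v w₀ w₁ w₂ (5 / 8))).re ≤
                ρ * ‖arrivalTransform Λ a v w₀ w₁ w₂ (5 / 8)‖ ^ 2 ∧
              ‖dressedTransform Λ a v w₀ w₁ w₂ (11 / 8)‖ ≤ lam * ‖arrivalTransform Λ a v w₀ w₁ w₂ (5 / 8)‖

/-- **(F) Dressed flattening** — as in `birth`. -/
def DressedFlattening : Prop :=
  ∀ ε : ℝ, 0 < ε → ∃ R : ℝ, ∀ (Λ : Finset HexVertex), SAW.hexDomainSimplyConnected Λ →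
    ∀ a ∈ SAW.hexDomainBoundary Λ, ∀ v ∈ Λ, v ∉ a →
      (∀ w : HexVertex, dist (hexCenter w) (hexCenter v) ≤ R → w ∈ Λ) →
        ∀ w₀ w₁ w₂ : HexVertex, hexGraph.Adj v w₀ → hexGraph.Adj v w₁ → hexGraph.Adj v w₂ →
          w₀ ≠ w₁ → w₁ ≠ w₂ → w₀ ≠ w₂ →
            ‖dressedTransform Λ a v w₀ w₁ w₂ (11 / 8)‖ ≤ ε * ‖arrivalTransform Λ a v w₀ w₁ w₂ (5 / 8)‖

/-! ### Name-keyed aliases (the skeleton audit matches hypotheses of `DressingTransfer_of` by stub name) -/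
namespace __Registered

/-- Alias of `ModeIdentities`. -/
abbrev stub_modeIdentities : Prop := ModeIdentities
/-- Alias of `SourceNoFold`. -/
abbrev stub_sourceNoFold : Prop := SourceNoFold
/-- Alias of `LoopHalfBound`. -/
abbrev stub_loopHalfBound : Prop := LoopHalfBound
/-- Alias of `SpreadBudget`. -/
abbrev stub_spreadBudget : Prop := SpreadBudget
/-- Alias of `DressedFlattening`. -/
abbrev stub_dressedFlattening : Prop := DressedFlattening

end __Registered

/-! ## 3. Registered stubs (`sorry` lives only here) -/

/-- **STUB A (M–L; PROVABLE NOW; shared with `birth`) — `ModeIdentities`.**  DCS's pair/triple grouping summed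
against the three `ℤ/3` characters of the ports (one-step exits `±π/3`, returning loops `±4π/3` with equal
reversed weight, `e^{-3iW}` constant over first arrivals); confirmed to machine precision on every vertex of the
7- and 19-cell flowers for every boundary source (this line's `exp/dressing.py`). -/
theorem stub_modeIdentities :
    ∀ (Λ : Finset HexVertex), SAW.hexDomainSimplyConnected Λ → ∀ a ∈ SAW.hexDomainBoundary Λ, ∀ v ∈ Λ, v ∉ a →
      ∀ w₀ w₁ w₂ : HexVertex, hexGraph.Adj v w₀ → hexGraph.Adj v w₁ → hexGraph.Adj v w₂ →
        w₀ ≠ w₁ → w₁ ≠ w₂ → w₀ ≠ w₂ →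
          trivialMode Λ a v w₀ w₁ w₂ =
              (alphaT : ℂ) * arrivalTransform Λ a v w₀ w₁ w₂ (5 / 8) -
                (Real.sqrt 3 : ℂ) * dressedTransform Λ a v w₀ w₁ w₂ (5 / 8) ∧
            ‖beltramiMode Λ a v w₀ w₁ w₂‖ ≤
              ‖(betaT : ℂ) * arrivalTransform Λ a v w₀ w₁ w₂ (11 / 8) +
                (Real.sqrt 3 : ℂ) * dressedTransform Λ a v w₀ w₁ w₂ (11 / 8)‖ := by
  sorry

/-- **STUB S (L; shared with `birth`, ≡ `SAWDevelopingMap.SourceLoopBound`) — `SourceNoFold`.** -/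
theorem stub_sourceNoFold :
    ∃ k : ℝ, k < 1 ∧ ∀ (Λ : Finset HexVertex), SAW.hexDomainSimplyConnected Λ → ∀ a ∈ SAW.hexDomainBoundary Λ,
      ∀ v ∈ Λ, v ∈ a → ∀ w₀ w₁ w₂ : HexVertex, hexGraph.Adj v w₀ → hexGraph.Adj v w₁ → hexGraph.Adj v w₂ →
        w₀ ≠ w₁ → w₁ ≠ w₂ → w₀ ≠ w₂ →
          ‖beltramiMode Λ a v w₀ w₁ w₂‖ ≤ k * ‖trivialMode Λ a v w₀ w₁ w₂‖ := by
  sorry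

/-- **STUB L (L; margin ≈ 1.5×) — `LoopHalfBound`.**  Why plausibly true: the sum is monotone in the domain and
`γ ∪ {v}` separates, so its sup is the whole-plane generating function of self-avoiding returns from port `k` to
port `i` avoiding `v` and a ray from `w_j`, of the non-separating winding type only: exactly `0.09369` summed to
length 34 (counts 1, 4, 3, 20, 33, 129, 296, 988, 2621, 8328, 23745, 74298, 220742, 688959 at lengths 5, 9, …, 33),
terms decaying like `n^{-3/2}` (rooted polygons), extrapolated sup `≈ 0.12–0.13`; threshold `sin(π/8)/2 = 0.191`.
Why it might fail / what is hard: the tail beyond length 34 is `≈ 0.03` by extrapolation only; rigorously only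
`≲ 0.92` is known (DCS sum rule in the slit domain `Λ ∖ (γ ∪ {v})`, which IS simply connected) — a sharper sum
rule, or a certified finite-length count plus a rooted-polygon tail bound, is needed; the same constant serves the
route's `LoopDressingBound` (threshold `0.383`) and `SourceNoFold`. -/
theorem stub_loopHalfBound :
    ∃ c : ℝ, c < Real.sin (Real.pi / 8) * spreadCut ∧ ∀ (Λ : Finset HexVertex), SAW.hexDomainSimplyConnected Λ →
      ∀ a ∈ SAW.hexDomainBoundary Λ, ∀ v ∈ Λ, ∀ w₀ w₁ w₂ : HexVertex,
        hexGraph.Adj v w₀ → hexGraph.Adj v w₁ → hexGraph.Adj v w₂ → w₀ ≠ w₁ → w₁ ≠ w₂ → w₀ ≠ w₂ →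
          ∀ γ : SAW.HexMidEdgeSAW (Λ.erase v) a s(v, w₀),
            (∑ η : SAW.HexMidEdgeSAW ((Λ.erase v) \ γ.verts.toFinset) s(v, w₁) s(v, w₂),
              SAW.hexCriticalFugacity ^ η.length) ≤ c := by
  sorry

/-- **STUB SB (XL; OPEN — the load-bearing one) — `SpreadBudget`.**  Why plausibly true: decompose each first
arrival at its last entrance into the ball `B_r(v)`; for fixed boundary datum (entrance point, heading, vertices of
`B_r(v)` used earlier) the law of `(W, L_γ)` is an exact convolution of a far winding law with a near law carrying
the dressing, so `D_s/G₅` is a ratio of LOCAL transforms provided the far sheet decorrelates from the near datum —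
the single-scale form of the mixing behind `ArrivalFlattening`.  The hypothesis `‖G₅‖ ≤ G₀/2` holds from depth ≈ 8
on (c = 0.585 / 0.47 / 0.40 / 0.36 / 0.30 at depth 5 / 9 / 13 / 17 / 25, `c ∼ R^{-0.42}`); measured there by validated
Monte Carlo (exp/mc, identities to 2e-3): cone = dom5 = 0.041 / 0.053 / 0.059 / 0.062 / 0.067 (creeping up ≈ 0.012
per e-fold of depth; dom5/m̄ = 1.26 → 1.64, m̄ → 0.041), dom11 = 0.014 / 0.013 / 0.012 / 0.010 / 0.009 (falling),
K = 0.20 / 0.14 / 0.11 / 0.10 / 0.077 (`∼ R^{-0.6}`) — `ρ + λ' ≈ 0.08` against `0.414` at depth 25; exact values at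
depth ≤ 5: dom5 ≤ 0.047, dom11 ≤ 0.037, class profile `m(W)` peaked like the near law.  Why it might fail — the precise
RACE: `‖G₅‖²` is a residual of cancellation between phase-aligned and anti-aligned winding classes, shrinking like
`R^{-0.84}`, while the numerator `Re(D₅ conj G₅)` inherits the cancellation only insofar as the dressing profile `m(W)`
is flat across far sheets; as long as anti-aligned classes are reached by LOCAL hooking (small `m`) the ratio inflates
(the measured creep), and SB needs the near entrance type to decorrelate from the far sheet at rate ≥ the cancellation
rate.  Far–near predicts the creep turns over once the far winding spread exceeds one phase period `2π/σ = 576°`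
(depth ∼ 10³–10⁴; log-extrapolated peak ≲ 0.13, inside the budget) and then decays to ≈ m̄ ≈ 0.04 — unverified beyond
depth 25.  Also: exact zeros of `G₅` with `D₅ ≠ 0` (degenerate, shared with birth). -/
theorem stub_spreadBudget :
    ∃ ρ lam : ℝ, 0 ≤ lam ∧ ρ + lam < 2 * SAW.hexCriticalFugacity * Real.sin (Real.pi / 8) ∧
      ∀ (Λ : Finset HexVertex), SAW.hexDomainSimplyConnected Λ → ∀ a ∈ SAW.hexDomainBoundary Λ, ∀ v ∈ Λ,
        v ∉ a → ∀ w₀ w₁ w₂ : HexVertex, hexGraph.Adj v w₀ → hexGraph.Adj v w₁ → hexGraph.Adj v w₂ →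
          w₀ ≠ w₁ → w₁ ≠ w₂ → w₀ ≠ w₂ →
            ‖arrivalTransform Λ a v w₀ w₁ w₂ (5 / 8)‖ ≤ spreadCut * arrivalMass Λ a v w₀ w₁ w₂ →
              (dressedTransform Λ a v w₀ w₁ w₂ (5 / 8) *
                  (starRingEnd ℂ) (arrivalTransform Λ a v w₀ w₁ w₂ (5 / 8))).re ≤
                  ρ * ‖arrivalTransform Λ a v w₀ w₁ w₂ (5 / 8)‖ ^ 2 ∧
                ‖dressedTransform Λ a v w₀ w₁ w₂ (11 / 8)‖ ≤
                  lam * ‖arrivalTransform Λ a v w₀ w₁ w₂ (5 / 8)‖ := by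
  sorry

/-- **STUB F (L–XL; OPEN, rides with `ArrivalFlattening`; shared with `birth`) — `DressedFlattening`.** -/
theorem stub_dressedFlattening :
    ∀ ε : ℝ, 0 < ε → ∃ R : ℝ, ∀ (Λ : Finset HexVertex), SAW.hexDomainSimplyConnected Λ →
      ∀ a ∈ SAW.hexDomainBoundary Λ, ∀ v ∈ Λ, v ∉ a →
        (∀ w : HexVertex, dist (hexCenter w) (hexCenter v) ≤ R → w ∈ Λ) →
          ∀ w₀ w₁ w₂ : HexVertex, hexGraph.Adj v w₀ → hexGraph.Adj v w₁ → hexGraph.Adj v w₂ →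
            w₀ ≠ w₁ → w₁ ≠ w₂ → w₀ ≠ w₂ →
              ‖dressedTransform Λ a v w₀ w₁ w₂ (11 / 8)‖ ≤ ε * ‖arrivalTransform Λ a v w₀ w₁ w₂ (5 / 8)‖ := by
  sorry

/-! ## 4. Sorry-free glue -/

/-- `0 < x_c < 1`, `0 < sin(π/8) < 1/2`, `0 < √3 < 2`. -/
theorem consts_bounds :
    0 < SAW.hexCriticalFugacity ∧ SAW.hexCriticalFugacity < 1 ∧ 0 < Real.sin (Real.pi / 8) ∧
      Real.sin (Real.pi / 8) < 1 / 2 ∧ 0 < Real.sqrt 3 ∧ Real.sqrt 3 < 2 := by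
  obtain ⟨hx0, hx1⟩ := SAW.hexCriticalFugacity_pos_lt_one
  refine ⟨hx0, hx1, ?_, ?_, ?_, ?_⟩
  · exact Real.sin_pos_of_pos_of_lt_pi (by positivity) (by linarith [Real.pi_pos])
  · rw [← Real.sin_pi_div_six]
    exact Real.sin_lt_sin_of_lt_of_le_pi_div_two (by linarith [Real.pi_pos]) (by linarith [Real.pi_pos])
      (by linarith [Real.pi_pos])
  · exact Real.sqrt_pos.2 (by norm_num)
  · exact (Real.sqrt_lt' (by norm_num)).2 (by norm_num)

/-- `cos(5π/24) − cos(11π/24) = √3 sin(π/8)`. -/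
theorem cos_sub_cos_ports :
    Real.cos (5 * Real.pi / 24) - Real.cos (11 * Real.pi / 24) = Real.sqrt 3 * Real.sin (Real.pi / 8) := by
  rw [Real.cos_sub_cos]
  have e1 : (5 * Real.pi / 24 + 11 * Real.pi / 24) / 2 = Real.pi / 3 := by ring
  have e2 : (5 * Real.pi / 24 - 11 * Real.pi / 24) / 2 = -(Real.pi / 8) := by ring
  rw [e1, e2, Real.sin_neg, Real.sin_pi_div_three]
  ring

/-- `1 < α_T`, `0 ≤ β_T`, and `α_T − β_T = 2√3 x_c sin(π/8)`. -/
theorem alphaT_betaT_bounds :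
    1 < alphaT ∧ 0 ≤ betaT ∧
      alphaT - betaT = Real.sqrt 3 * (2 * SAW.hexCriticalFugacity * Real.sin (Real.pi / 8)) := by
  obtain ⟨hx0, -, -⟩ := consts_bounds
  have hc5 : 0 < Real.cos (5 * Real.pi / 24) :=
    Real.cos_pos_of_mem_Ioo ⟨by linarith [Real.pi_pos], by linarith [Real.pi_pos]⟩
  have hc11 : 0 ≤ Real.cos (11 * Real.pi / 24) :=
    Real.cos_nonneg_of_mem_Icc ⟨by linarith [Real.pi_pos], by linarith [Real.pi_pos]⟩
  refine ⟨?_, ?_, ?_⟩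
  · have : 0 < 2 * SAW.hexCriticalFugacity * Real.cos (5 * Real.pi / 24) := by positivity
    simp only [alphaT]; linarith
  · have : 0 ≤ 2 * SAW.hexCriticalFugacity * Real.cos (11 * Real.pi / 24) := by positivity
    simp only [betaT]; linarith
  · simp only [alphaT, betaT]
    linear_combination (2 * SAW.hexCriticalFugacity) * cos_sub_cos_ports

/-- **Budget constants.**  If `0 ≤ λ'` and `ρ + λ' < 2 x_c sin(π/8)` then `0 < α_T − √3ρ` and the no-fold constant
`k = (β_T + √3λ')/(α_T − √3ρ)` lies in `[0, 1)`. -/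
theorem budget_consts {ρ lam : ℝ} (h0 : 0 ≤ lam)
    (hb : ρ + lam < 2 * SAW.hexCriticalFugacity * Real.sin (Real.pi / 8)) :
    0 < alphaT - Real.sqrt 3 * ρ ∧ 0 ≤ (betaT + Real.sqrt 3 * lam) / (alphaT - Real.sqrt 3 * ρ) ∧
      (betaT + Real.sqrt 3 * lam) / (alphaT - Real.sqrt 3 * ρ) < 1 := by
  obtain ⟨-, -, -, -, h30, -⟩ := consts_bounds
  obtain ⟨-, hβ, hdiff⟩ := alphaT_betaT_bounds
  have h1 : Real.sqrt 3 * (ρ + lam) < Real.sqrt 3 * (2 * SAW.hexCriticalFugacity * Real.sin (Real.pi / 8)) :=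
    mul_lt_mul_of_pos_left hb h30
  have hnum : 0 ≤ betaT + Real.sqrt 3 * lam := by positivity
  have hlt : betaT + Real.sqrt 3 * lam < alphaT - Real.sqrt 3 * ρ := by nlinarith
  have hpos : 0 < alphaT - Real.sqrt 3 * ρ := lt_of_le_of_lt hnum hlt
  exact ⟨hpos, div_nonneg hnum hpos.le, (div_lt_one hpos).2 hlt⟩

/-- A vertex at depth `≥ 2` is not on the boundary mid-edge `a` (as in `birth`). -/
theorem not_mem_of_deep {Λ : Finset HexVertex} {a : Sym2 HexVertex} {v : HexVertex} {R : ℝ}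
    (ha : a ∈ SAW.hexDomainBoundary Λ) (hv : v ∈ Λ)
    (hdeep : ∀ w : HexVertex, dist (hexCenter w) (hexCenter v) ≤ R → w ∈ Λ) (hR : 2 ≤ R) : v ∉ a := by
  intro hva
  obtain ⟨he, u, u', rfl, hu', hu⟩ := ha
  have hvu' : v = u' := by
    rcases Sym2.mem_iff.1 hva with h | h
    · exact absurd (h ▸ hv) hu
    · exact h
  subst hvu'
  have hadj : hexGraph.Adj u v := (SimpleGraph.mem_edgeSet hexGraph).1 he
  have hcard := ((hexGraph_adj_iff u v).1 hadj).2
  obtain ⟨p, hp⟩ := Finset.card_pos.1 (by rw [hcard]; norm_num)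
  rw [Finset.mem_inter] at hp
  have h1 := Literature.Probability.Percolation.dist_triMeshPoint_hexCenter_le hp.1 1
  have h2 := Literature.Probability.Percolation.dist_triMeshPoint_hexCenter_le hp.2 1
  simp only [abs_one, Complex.ofReal_one, one_mul] at h1 h2
  have hdist : dist (hexCenter u) (hexCenter v) ≤ 2 :=
    calc dist (hexCenter u) (hexCenter v)
        ≤ dist (hexCenter u) (triMeshPoint 1 p) + dist (triMeshPoint 1 p) (hexCenter v) := dist_triangle _ _ _
      _ ≤ 1 + 1 := add_le_add (by rwa [dist_comm] at h1) h2
      _ = 2 := by norm_num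
  exact hu (hdeep u (hdist.trans hR))

/-- The loop dressing is non-negative. -/
theorem loopDressing_nonneg (Λ : Finset HexVertex) (v : HexVertex) {a z : Sym2 HexVertex}
    (γ : SAW.HexMidEdgeSAW (Λ.erase v) a z) (w w' : HexVertex) : 0 ≤ loopDressing Λ v γ w w' := by
  obtain ⟨hx0, -⟩ := SAW.hexCriticalFugacity_pos_lt_one
  unfold loopDressing
  exact mul_nonneg hx0.le (Finset.sum_nonneg fun η _ => pow_nonneg hx0.le _)

/-- One port of `‖D_s‖ ≤ L★·G₀`: if every dressing of the prefixes at this port is `≤ L★` then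
`‖Σ_γ w_s(γ)·L_γ‖ ≤ L★ · Σ_γ x_c^{ℓ(γ)}`. -/
theorem norm_sum_weight_mul_le {Λ : Finset HexVertex} {v : HexVertex} {a z : Sym2 HexVertex} {s Lstar : ℝ}
    {w w' : HexVertex} (hL : ∀ γ : SAW.HexMidEdgeSAW (Λ.erase v) a z, loopDressing Λ v γ w w' ≤ Lstar) :
    ‖∑ γ : SAW.HexMidEdgeSAW (Λ.erase v) a z,
        γ.weight SAW.hexCriticalFugacity s * (loopDressing Λ v γ w w' : ℂ)‖ ≤
      Lstar * ∑ γ : SAW.HexMidEdgeSAW (Λ.erase v) a z, SAW.hexCriticalFugacity ^ γ.length := by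
  obtain ⟨hx0, -⟩ := SAW.hexCriticalFugacity_pos_lt_one
  refine (norm_sum_le _ _).trans ?_
  rw [Finset.mul_sum]
  refine Finset.sum_le_sum fun γ _ => ?_
  rw [norm_mul, γ.norm_weight hx0.le s, Complex.norm_real, Real.norm_of_nonneg (loopDressing_nonneg Λ v γ w w'),
    mul_comm]
  exact mul_le_mul_of_nonneg_right (hL γ) (pow_nonneg hx0.le _)

/-- **`‖D_s‖ ≤ L★ · G₀`** from a port-wise bound `L_γ ≤ L★` on the dressings. -/
theorem norm_dressedTransform_le {Λ : Finset HexVertex} {a : Sym2 HexVertex} {v w₀ w₁ w₂ : HexVertex}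
    {s Lstar : ℝ}
    (h0 : ∀ γ : SAW.HexMidEdgeSAW (Λ.erase v) a s(v, w₀), loopDressing Λ v γ w₁ w₂ ≤ Lstar)
    (h1 : ∀ γ : SAW.HexMidEdgeSAW (Λ.erase v) a s(v, w₁), loopDressing Λ v γ w₂ w₀ ≤ Lstar)
    (h2 : ∀ γ : SAW.HexMidEdgeSAW (Λ.erase v) a s(v, w₂), loopDressing Λ v γ w₀ w₁ ≤ Lstar) :
    ‖dressedTransform Λ a v w₀ w₁ w₂ s‖ ≤ Lstar * arrivalMass Λ a v w₀ w₁ w₂ := by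
  unfold dressedTransform arrivalMass
  have e0 := norm_sum_weight_mul_le (s := s) h0
  have e1 := norm_sum_weight_mul_le (s := s) h1
  have e2 := norm_sum_weight_mul_le (s := s) h2
  calc _ ≤ _ := norm_add₃_le
    _ ≤ _ := add_le_add (add_le_add e0 e1) e2
    _ = _ := by ring

/-- **Beltrami upper bound.**  From (I2), the (FM)-type ratio `‖G₁₁‖ ≤ t‖G₅‖` and `‖D₁₁‖ ≤ λ'‖G₅‖`:
`‖B‖ ≤ (β_T t + √3λ')‖G₅‖`. -/
theorem beltrami_upper {B G5 G11 D11 : ℂ} {t lam : ℝ}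
    (hB : ‖B‖ ≤ ‖(betaT : ℂ) * G11 + (Real.sqrt 3 : ℂ) * D11‖)
    (hFM : ‖G11‖ ≤ t * ‖G5‖) (hdom : ‖D11‖ ≤ lam * ‖G5‖) :
    ‖B‖ ≤ (betaT * t + Real.sqrt 3 * lam) * ‖G5‖ := by
  obtain ⟨-, hβ, -⟩ := alphaT_betaT_bounds
  have h3 : 0 ≤ Real.sqrt 3 := Real.sqrt_nonneg 3
  have hB' : ‖B‖ ≤ betaT * ‖G11‖ + Real.sqrt 3 * ‖D11‖ := by
    refine hB.trans ((norm_add_le _ _).trans (le_of_eq ?_))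
    rw [norm_mul, norm_mul, Complex.norm_real, Complex.norm_real, Real.norm_of_nonneg hβ,
      Real.norm_of_nonneg h3]
  have e1 := mul_le_mul_of_nonneg_left hFM hβ
  have e2 := mul_le_mul_of_nonneg_left hdom h3
  nlinarith [e1, e2]

/-- **Trivial-mode lower bound (the in-phase cone).**  From (I1) `ΣF = α_T G₅ − √3 D₅` and the in-phase bound
`Re(D₅ conj G₅) ≤ ρ‖G₅‖²`: `(α_T − √3ρ)‖G₅‖ ≤ ‖ΣF‖` (no upper bound on `‖D₅‖` is needed). -/
theorem trivial_lower {T G5 D5 : ℂ} {ρ : ℝ}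
    (hT : T = (alphaT : ℂ) * G5 - (Real.sqrt 3 : ℂ) * D5)
    (hcone : (D5 * (starRingEnd ℂ) G5).re ≤ ρ * ‖G5‖ ^ 2) :
    (alphaT - Real.sqrt 3 * ρ) * ‖G5‖ ≤ ‖T‖ := by
  have h3 : 0 ≤ Real.sqrt 3 := Real.sqrt_nonneg 3
  have hGG : (G5 * (starRingEnd ℂ) G5).re = ‖G5‖ ^ 2 := by
    rw [Complex.mul_conj, Complex.ofReal_re, Complex.normSq_eq_norm_sq]
  have hre : (T * (starRingEnd ℂ) G5).re =
      alphaT * ‖G5‖ ^ 2 - Real.sqrt 3 * (D5 * (starRingEnd ℂ) G5).re := by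
    rw [hT, sub_mul, Complex.sub_re, mul_assoc, mul_assoc, Complex.re_ofReal_mul, Complex.re_ofReal_mul, hGG]
  have hup : (T * (starRingEnd ℂ) G5).re ≤ ‖T‖ * ‖G5‖ := by
    refine (Complex.re_le_norm _).trans (le_of_eq ?_)
    rw [norm_mul, Complex.norm_conj]
  have hG0 : 0 ≤ ‖G5‖ := norm_nonneg _
  have hT0 : 0 ≤ ‖T‖ := norm_nonneg _
  have key : (alphaT - Real.sqrt 3 * ρ) * ‖G5‖ ^ 2 ≤ ‖T‖ * ‖G5‖ := by
    have e := mul_le_mul_of_nonneg_left hcone h3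
    nlinarith [e, hre, hup]
  by_cases hG : ‖G5‖ = 0
  · rw [hG, mul_zero]; exact hT0
  · have hGpos : 0 < ‖G5‖ := lt_of_le_of_ne hG0 (Ne.symm hG)
    have : (alphaT - Real.sqrt 3 * ρ) * ‖G5‖ * ‖G5‖ ≤ ‖T‖ * ‖G5‖ := by nlinarith [key]
    exact le_of_mul_le_mul_right this hGpos

/-- **`DressingTransfer_of`: A → S → L → SB → F → `DressingTransfer`** (kernel-checked, no `sorry`; both
antecedents (FM) and (WCLT) of the crux are consumed).  (K): at `v ∈ a` by (S); at `v ∉ a` the budget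
`(ρ̃, λ̃)` is `(2L★, 2L★)` with `L★ = x_c·max(c,0)` at a concentrated vertex (stub L + `norm_dressedTransform_le`)
and `(ρ, λ')` at a spread one (stub SB); `beltrami_upper` + `trivial_lower` + `budget_consts` give `‖B‖ ≤ k‖ΣF‖` with
`k = max(k_S, k_conc, k_spread) < 1`.  (M): at depth `R = max(max R_WCLT(ε') R_F(ε'), 2)` the vertex is off `a`,
`‖B‖ ≤ (β_T + √3)ε'‖G₅‖` by (I2)+(WCLT)+(F) and `‖ΣF‖ ≥ (α_T − √3ρ_M)‖G₅‖` with `ρ_M = max(L★/θ, ρ)` in both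
regimes, `ε' = ε(α_T − √3ρ_M)/(β_T + √3 + 1)`. -/
theorem DressingTransfer_of (hA : __Registered.stub_modeIdentities) (hS : __Registered.stub_sourceNoFold)
    (hL : __Registered.stub_loopHalfBound) (hSB : __Registered.stub_spreadBudget)
    (hF : __Registered.stub_dressedFlattening) :
    Summit.CriticalPhenomena.SAWScalingLimit.Theses.SAWSpinMonotone.DressingTransfer := by
  intro hFM hAF
  obtain ⟨kS, hkS, hS⟩ := hS
  obtain ⟨cL, hcL, hL⟩ := hL
  obtain ⟨ρ, lam, hlam0, hbud, hSB⟩ := hSB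
  obtain ⟨hx0, hx1, hs0, hs1, h30, h32⟩ := consts_bounds
  obtain ⟨hα, hβ, hdiff⟩ := alphaT_betaT_bounds
  have h3 : 0 ≤ Real.sqrt 3 := h30.le
  have h5 : (5 / 8 : ℝ) ∈ Set.Icc (0 : ℝ) (3 / 2) := ⟨by norm_num, by norm_num⟩
  have h11 : (11 / 8 : ℝ) ∈ Set.Icc (0 : ℝ) (3 / 2) := ⟨by norm_num, by norm_num⟩
  -- the concentrated-regime budget: L★ = x_c · max(c_L, 0), ρ_c = λ_c = 2L★, 4L★ < 2 x_c sin(π/8)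
  have hθ : 0 < spreadCut := spreadCut_pos
  set Lstar : ℝ := SAW.hexCriticalFugacity * max cL 0 with hLstar
  have hLstar0 : 0 ≤ Lstar := by positivity
  have hmax : max cL 0 < Real.sin (Real.pi / 8) * spreadCut := max_lt hcL (by positivity)
  -- concentrated budget ρ_c = λ_c = L★/θ:  2L★/θ < 2 x_c sin(π/8)  ⟸  x_c · max(c,0) < x_c · θ sin(π/8)
  have hbudc : Lstar / spreadCut + Lstar / spreadCut < 2 * SAW.hexCriticalFugacity * Real.sin (Real.pi / 8) := by
    have h1 : Lstar < SAW.hexCriticalFugacity * (Real.sin (Real.pi / 8) * spreadCut) := by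
      rw [hLstar]; exact mul_lt_mul_of_pos_left hmax hx0
    have h2 : Lstar / spreadCut < SAW.hexCriticalFugacity * Real.sin (Real.pi / 8) := by
      rw [div_lt_iff₀ hθ]; nlinarith
    linarith
  have hLθ0 : 0 ≤ Lstar / spreadCut := div_nonneg hLstar0 hθ.le
  -- port-wise dressing bounds from stub L (any labelling of the ports)
  have hLd : ∀ (Λ : Finset HexVertex), SAW.hexDomainSimplyConnected Λ → ∀ a ∈ SAW.hexDomainBoundary Λ,
      ∀ v ∈ Λ, ∀ w₀ w₁ w₂ : HexVertex, hexGraph.Adj v w₀ → hexGraph.Adj v w₁ → hexGraph.Adj v w₂ →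
        w₀ ≠ w₁ → w₁ ≠ w₂ → w₀ ≠ w₂ →
          ∀ γ : SAW.HexMidEdgeSAW (Λ.erase v) a s(v, w₀), loopDressing Λ v γ w₁ w₂ ≤ Lstar := by
    intro Λ hΛ a ha v hv w₀ w₁ w₂ hw₀ hw₁ hw₂ h01 h12 h02 γ
    have hz := hL Λ hΛ a ha v hv w₀ w₁ w₂ hw₀ hw₁ hw₂ h01 h12 h02 γ
    unfold loopDressing
    rw [hLstar]
    exact mul_le_mul_of_nonneg_left (hz.trans (le_max_left _ _)) hx0.le
  have hDmass : ∀ (Λ : Finset HexVertex), SAW.hexDomainSimplyConnected Λ → ∀ a ∈ SAW.hexDomainBoundary Λ,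
      ∀ v ∈ Λ, ∀ w₀ w₁ w₂ : HexVertex, hexGraph.Adj v w₀ → hexGraph.Adj v w₁ → hexGraph.Adj v w₂ →
        w₀ ≠ w₁ → w₁ ≠ w₂ → w₀ ≠ w₂ → ∀ s : ℝ,
          ‖dressedTransform Λ a v w₀ w₁ w₂ s‖ ≤ Lstar * arrivalMass Λ a v w₀ w₁ w₂ := by
    intro Λ hΛ a ha v hv w₀ w₁ w₂ hw₀ hw₁ hw₂ h01 h12 h02 s
    exact norm_dressedTransform_le (hLd Λ hΛ a ha v hv w₀ w₁ w₂ hw₀ hw₁ hw₂ h01 h12 h02)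
      (hLd Λ hΛ a ha v hv w₁ w₂ w₀ hw₁ hw₂ hw₀ h12 h02.symm h01.symm)
      (hLd Λ hΛ a ha v hv w₂ w₀ w₁ hw₂ hw₀ hw₁ h02.symm h01 h12.symm)
  -- unified budget at every v ∉ a: some (ρ̃, λ̃) ∈ {(2L★,2L★), (ρ,λ')}
  set ρM : ℝ := max (Lstar / spreadCut) ρ with hρM
  have hbudget : ∀ (Λ : Finset HexVertex), SAW.hexDomainSimplyConnected Λ → ∀ a ∈ SAW.hexDomainBoundary Λ,
      ∀ v ∈ Λ, v ∉ a → ∀ w₀ w₁ w₂ : HexVertex, hexGraph.Adj v w₀ → hexGraph.Adj v w₁ → hexGraph.Adj v w₂ →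
        w₀ ≠ w₁ → w₁ ≠ w₂ → w₀ ≠ w₂ →
          ∃ ρ' lam' : ℝ, ((ρ' = Lstar / spreadCut ∧ lam' = Lstar / spreadCut) ∨ (ρ' = ρ ∧ lam' = lam)) ∧
            (dressedTransform Λ a v w₀ w₁ w₂ (5 / 8) *
                (starRingEnd ℂ) (arrivalTransform Λ a v w₀ w₁ w₂ (5 / 8))).re ≤
                ρ' * ‖arrivalTransform Λ a v w₀ w₁ w₂ (5 / 8)‖ ^ 2 ∧
              ‖dressedTransform Λ a v w₀ w₁ w₂ (11 / 8)‖ ≤ lam' * ‖arrivalTransform Λ a v w₀ w₁ w₂ (5 / 8)‖ := by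
    intro Λ hΛ a ha v hv hva w₀ w₁ w₂ hw₀ hw₁ hw₂ h01 h12 h02
    by_cases hsp : ‖arrivalTransform Λ a v w₀ w₁ w₂ (5 / 8)‖ ≤ spreadCut * arrivalMass Λ a v w₀ w₁ w₂
    · obtain ⟨hc, hd⟩ := hSB Λ hΛ a ha v hv hva w₀ w₁ w₂ hw₀ hw₁ hw₂ h01 h12 h02 hsp
      exact ⟨ρ, lam, Or.inr ⟨rfl, rfl⟩, hc, hd⟩
    · rw [not_le] at hsp
      set g := ‖arrivalTransform Λ a v w₀ w₁ w₂ (5 / 8)‖ with hg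
      -- concentrated: θ·G₀ < g, so L★·G₀ < (L★/θ)·g
      have hmass : Lstar * arrivalMass Λ a v w₀ w₁ w₂ ≤ Lstar / spreadCut * g := by
        have h1 : arrivalMass Λ a v w₀ w₁ w₂ ≤ g / spreadCut := by
          rw [le_div_iff₀ hθ]; linarith
        have h2 := mul_le_mul_of_nonneg_left h1 hLstar0
        calc Lstar * arrivalMass Λ a v w₀ w₁ w₂ ≤ Lstar * (g / spreadCut) := h2
          _ = Lstar / spreadCut * g := by ring
      have hd5 := hDmass Λ hΛ a ha v hv w₀ w₁ w₂ hw₀ hw₁ hw₂ h01 h12 h02 (5 / 8)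
      have hd11 := hDmass Λ hΛ a ha v hv w₀ w₁ w₂ hw₀ hw₁ hw₂ h01 h12 h02 (11 / 8)
      have hd5' : ‖dressedTransform Λ a v w₀ w₁ w₂ (5 / 8)‖ ≤ Lstar / spreadCut * g := hd5.trans hmass
      have hd11' : ‖dressedTransform Λ a v w₀ w₁ w₂ (11 / 8)‖ ≤ Lstar / spreadCut * g := hd11.trans hmass
      refine ⟨Lstar / spreadCut, Lstar / spreadCut, Or.inl ⟨rfl, rfl⟩, ?_, hd11'⟩
      calc (dressedTransform Λ a v w₀ w₁ w₂ (5 / 8) *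
              (starRingEnd ℂ) (arrivalTransform Λ a v w₀ w₁ w₂ (5 / 8))).re
          ≤ ‖dressedTransform Λ a v w₀ w₁ w₂ (5 / 8) *
              (starRingEnd ℂ) (arrivalTransform Λ a v w₀ w₁ w₂ (5 / 8))‖ := Complex.re_le_norm _
        _ = ‖dressedTransform Λ a v w₀ w₁ w₂ (5 / 8)‖ * g := by rw [norm_mul, Complex.norm_conj]
        _ ≤ Lstar / spreadCut * g * g := mul_le_mul_of_nonneg_right hd5' (norm_nonneg _)
        _ = Lstar / spreadCut * g ^ 2 := by ring
  -- constants
  obtain ⟨hposc, hkc0, hkc1⟩ := budget_consts (ρ := Lstar / spreadCut) (lam := Lstar / spreadCut) hLθ0 hbudc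
  obtain ⟨hposs, hks0, hks1⟩ := budget_consts hlam0 hbud
  set kc : ℝ := (betaT + Real.sqrt 3 * (Lstar / spreadCut)) / (alphaT - Real.sqrt 3 * (Lstar / spreadCut))
    with hkc
  set ks : ℝ := (betaT + Real.sqrt 3 * lam) / (alphaT - Real.sqrt 3 * ρ) with hks
  have hρM_lt : Real.sqrt 3 * ρM < alphaT := by
    rcases le_total (Lstar / spreadCut) ρ with h | h
    · rw [hρM, max_eq_right h]; linarith
    · rw [hρM, max_eq_left h]; linarith
  refine ⟨⟨max kS (max kc ks), max_lt hkS (max_lt hkc1 hks1), ?_⟩, ?_⟩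
  · -- (K)
    intro Λ hΛ a ha v hv w₀ w₁ w₂ hw₀ hw₁ hw₂ h01 h12 h02
    show ‖beltramiMode Λ a v w₀ w₁ w₂‖ ≤ max kS (max kc ks) * ‖trivialMode Λ a v w₀ w₁ w₂‖
    by_cases hva : v ∈ a
    · exact (hS Λ hΛ a ha v hv hva w₀ w₁ w₂ hw₀ hw₁ hw₂ h01 h12 h02).trans
        (mul_le_mul_of_nonneg_right (le_max_left _ _) (norm_nonneg _))
    · obtain ⟨hI1, hI2⟩ := hA Λ hΛ a ha v hv hva w₀ w₁ w₂ hw₀ hw₁ hw₂ h01 h12 h02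
      have hg : ‖arrivalTransform Λ a v w₀ w₁ w₂ (11 / 8)‖ ≤ ‖arrivalTransform Λ a v w₀ w₁ w₂ (5 / 8)‖ :=
        hFM Λ hΛ a ha v hv w₀ w₁ w₂ hw₀ hw₁ hw₂ h01 h12 h02 h5 h11 (by norm_num)
      obtain ⟨ρ', lam', hcase, hc, hd⟩ := hbudget Λ hΛ a ha v hv hva w₀ w₁ w₂ hw₀ hw₁ hw₂ h01 h12 h02
      have hb := beltrami_upper (t := 1) hI2 (by simpa using hg) hd
      have ht := trivial_lower hI1 hc
      set g := ‖arrivalTransform Λ a v w₀ w₁ w₂ (5 / 8)‖ with hg_def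
      have hg0 : 0 ≤ g := norm_nonneg _
      have hlam'0 : 0 ≤ lam' := by
        rcases hcase with ⟨-, h2⟩ | ⟨-, h2⟩
        · rw [h2]; exact hLθ0
        · rw [h2]; exact hlam0
      have hbud' : ρ' + lam' < 2 * SAW.hexCriticalFugacity * Real.sin (Real.pi / 8) := by
        rcases hcase with ⟨h1, h2⟩ | ⟨h1, h2⟩
        · rw [h1, h2]; exact hbudc
        · rw [h1, h2]; exact hbud
      obtain ⟨hpos', hk'0, hk'1⟩ := budget_consts hlam'0 hbud'
      have hk'le : (betaT + Real.sqrt 3 * lam') / (alphaT - Real.sqrt 3 * ρ') ≤ max kc ks := by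
        rcases hcase with ⟨h1, h2⟩ | ⟨h1, h2⟩
        · rw [h1, h2]; exact le_max_left _ _
        · rw [h1, h2]; exact le_max_right _ _
      have hgt : g ≤ ‖trivialMode Λ a v w₀ w₁ w₂‖ / (alphaT - Real.sqrt 3 * ρ') := by
        rw [le_div_iff₀ hpos']; linarith
      have hnum0 : 0 ≤ betaT + Real.sqrt 3 * lam' := by positivity
      calc ‖beltramiMode Λ a v w₀ w₁ w₂‖ ≤ (betaT * 1 + Real.sqrt 3 * lam') * g := hb
        _ = (betaT + Real.sqrt 3 * lam') * g := by ring
        _ ≤ (betaT + Real.sqrt 3 * lam') * (‖trivialMode Λ a v w₀ w₁ w₂‖ / (alphaT - Real.sqrt 3 * ρ')) :=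
            mul_le_mul_of_nonneg_left hgt hnum0
        _ = (betaT + Real.sqrt 3 * lam') / (alphaT - Real.sqrt 3 * ρ') * ‖trivialMode Λ a v w₀ w₁ w₂‖ := by
            ring
        _ ≤ max kS (max kc ks) * ‖trivialMode Λ a v w₀ w₁ w₂‖ :=
            mul_le_mul_of_nonneg_right (hk'le.trans (le_max_right _ _)) (norm_nonneg _)
  · -- (M)
    intro ε hε
    have hden : 0 < alphaT - Real.sqrt 3 * ρM := by linarith
    set M₀ : ℝ := betaT + Real.sqrt 3 + 1 with hM₀
    have hM₀pos : 0 < M₀ := by positivity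
    set ε' : ℝ := ε * (alphaT - Real.sqrt 3 * ρM) / M₀ with hε'
    have hε'pos : 0 < ε' := by positivity
    have hMε : M₀ * ε' = ε * (alphaT - Real.sqrt 3 * ρM) := by
      rw [hε']; field_simp
    obtain ⟨R₁, hR₁⟩ := hAF ε' hε'pos
    obtain ⟨R₂, hR₂⟩ := hF ε' hε'pos
    refine ⟨max (max R₁ R₂) 2, ?_⟩
    intro Λ hΛ a ha v hv hdeep w₀ w₁ w₂ hw₀ hw₁ hw₂ h01 h12 h02
    show ‖beltramiMode Λ a v w₀ w₁ w₂‖ ≤ ε * ‖trivialMode Λ a v w₀ w₁ w₂‖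
    have hdeep₁ : ∀ w : HexVertex, dist (hexCenter w) (hexCenter v) ≤ R₁ → w ∈ Λ :=
      fun w hw => hdeep w (hw.trans ((le_max_left _ _).trans (le_max_left _ _)))
    have hdeep₂ : ∀ w : HexVertex, dist (hexCenter w) (hexCenter v) ≤ R₂ → w ∈ Λ :=
      fun w hw => hdeep w (hw.trans ((le_max_right _ _).trans (le_max_left _ _)))
    have hva : v ∉ a := not_mem_of_deep ha hv hdeep (le_max_right _ _)
    obtain ⟨hI1, hI2⟩ := hA Λ hΛ a ha v hv hva w₀ w₁ w₂ hw₀ hw₁ hw₂ h01 h12 h02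
    obtain ⟨ρ', lam', hcase, hc, -⟩ := hbudget Λ hΛ a ha v hv hva w₀ w₁ w₂ hw₀ hw₁ hw₂ h01 h12 h02
    have hρ'le : ρ' ≤ ρM := by
      rcases hcase with ⟨rfl, -⟩ | ⟨rfl, -⟩
      · exact le_max_left _ _
      · exact le_max_right _ _
    have hg : ‖arrivalTransform Λ a v w₀ w₁ w₂ (11 / 8)‖ ≤ ε' * ‖arrivalTransform Λ a v w₀ w₁ w₂ (5 / 8)‖ :=
      hR₁ Λ hΛ a ha v hv hdeep₁ w₀ w₁ w₂ hw₀ hw₁ hw₂ h01 h12 h02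
    have hd11 : ‖dressedTransform Λ a v w₀ w₁ w₂ (11 / 8)‖ ≤ ε' * ‖arrivalTransform Λ a v w₀ w₁ w₂ (5 / 8)‖ :=
      hR₂ Λ hΛ a ha v hv hva hdeep₂ w₀ w₁ w₂ hw₀ hw₁ hw₂ h01 h12 h02
    set g := ‖arrivalTransform Λ a v w₀ w₁ w₂ (5 / 8)‖ with hg_def
    have hg0 : 0 ≤ g := norm_nonneg _
    -- cone bound with ρM (weaken ρ' ≤ ρM)
    have hcM : (dressedTransform Λ a v w₀ w₁ w₂ (5 / 8) *
        (starRingEnd ℂ) (arrivalTransform Λ a v w₀ w₁ w₂ (5 / 8))).re ≤ ρM * g ^ 2 :=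
      hc.trans (mul_le_mul_of_nonneg_right hρ'le (by positivity))
    have ht := trivial_lower hI1 hcM
    have hb := beltrami_upper hI2 hg hd11
    have hεg : 0 ≤ ε' * g := by positivity
    calc ‖beltramiMode Λ a v w₀ w₁ w₂‖ ≤ (betaT * ε' + Real.sqrt 3 * ε') * g := hb
      _ = (betaT + Real.sqrt 3) * (ε' * g) := by ring
      _ ≤ M₀ * (ε' * g) := mul_le_mul_of_nonneg_right (by rw [hM₀]; linarith) hεg
      _ = ε * ((alphaT - Real.sqrt 3 * ρM) * g) := by rw [← mul_assoc, hMε]; ring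
      _ ≤ ε * ‖trivialMode Λ a v w₀ w₁ w₂‖ := mul_le_mul_of_nonneg_left ht hε.le

/-- Wiring check: the registered stubs feed the skeleton theorem. -/
example : Summit.CriticalPhenomena.SAWScalingLimit.Theses.SAWSpinMonotone.DressingTransfer :=
  DressingTransfer_of stub_modeIdentities stub_sourceNoFold stub_loopHalfBound stub_spreadBudget
    stub_dressedFlattening

end Summit.CriticalPhenomena.SAWScalingLimit.Cruxes.DressingTransfer.Farnear

end
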